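import Summits.NavierStokesRegularity.NavierStokesRegularity.Theorems.ScenarioCensusLargeOrderRigidityV

/-!
# Scenario census, rows F13m / F13mL / F13dL — profile rigidity at diverging symmetry order:
# part 6/6: the composition (P) + (V) + (Z) ⇒ S2ᴰ by the trichotomy on the centres;
# `profileRigidity_of`, `profileRigidityD`

Port of the ideator's tree-ready kit (ns-idea-9 g6, LINE 14 «dihedral_noswirl» REV 7 025308a3fa185027; kit file 1
`pub/ideators/ns-idea-9/lines/dihedral_noswirl/landing/ScenarioCensusLargeOrderRigidity.lean`, sha16 9e20ac97d4307bb6, 1417 l., its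
declarations identical in REV 6/7; ref g7 PRE-CHECK ✓ §12.34, critic idea-crit-8 V56/V57/V58 PASS) by typer seat ns-census-typer-2 g8
(lead g8 GO 2026-08-28T18:02Z; census FROZEN v1.62 — sub-row F13dL flips to TREE on port ACCEPT + ref CHECK), split for the
400-line rule into SIX modules `ScenarioCensusLargeOrderRigidity{Vocab, Statements, P, Geom, V}` → `ScenarioCensusLargeOrderRigidity`
(this last name is the kit's, so that kit file 2 `ScenarioCensusRowF13dLargeL3.lean` — ported by typer-1 g5 — imports it unchanged).
Declarations VERBATIM in the kit's namespace `…Theorems.ScenarioCensus.LargeOrderRigidity`; the only edits: the kit's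
`local notation "ℝ³"` is replaced by the abbreviation `R3` (typer lint: no notation in ported files) and one-line docstrings are
added to undocumented auxiliaries.

No census ROW value and no summit statement is proved in this file; `Row_F13mLarge` stays OPEN.
-/

noncomputable section

set_option linter.dupNamespace false
set_option linter.unusedVariables false

open Set Function Filter Topology MeasureTheory Metric TopologicalSpace
open scoped NNReal ENNReal RealInnerProductSpace

namespace Summit.NavierStokesRegularity.NavierStokesRegularity.Theorems.ScenarioCensus.LargeOrderRigidity

open Literature.Analysis Literature.Analysis.FluidPDE
open Summit.NavierStokesRegularity.NavierStokesRegularity.Theorems.ScenarioCensus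


/-! ### the composition: (P) + (V) + (Z) ⇒ S2, by the trichotomy on the centres -/

section Composition

variable {M : ℝ≥0} {m : ℕ → ℕ} {c : ℕ → R3} {a : ℕ → R3 → R3} {f : R3 → R3}

/-- **Case (i), rotations.**  If the centres converge, `c_j → ξ`, then (D) + (E) + (P) make the weak limit
a.e.-axisymmetric about the axis through `ξ`. -/
theorem aeAxisymmetric_of_tendsto_centres (hP : WeakLimitEquivariance)
    (hm : Tendsto m atTop atTop)
    (ha : ∀ j, MemLp (a j) 3 volume ∧ eLpNorm (a j) 3 volume ≤ (M : ℝ≥0∞))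
    (hsym : ∀ j, IsCyclicEquivariantAbout (m j) (c j) (a j))
    (hf : MemLp f 3 volume) (hweak : WeakTo a f) {ξ : R3} (hcξ : Tendsto c atTop (𝓝 ξ)) :
    IsAEAxisymmetricAbout ξ f := by
  intro θ
  -- reduce to `θ₀ ∈ [0, 2π)` congruent to `θ`
  set θ₀ : ℝ := θ - ⌊θ / (2 * Real.pi)⌋ * (2 * Real.pi) with hθ₀
  have hθ₀0 : 0 ≤ θ₀ := Int.sub_floor_div_mul_nonneg θ (by positivity)
  have hrot : ∀ x, rotZ θ x = rotZ θ₀ x := fun x => (rotZ_sub_int_mul_two_pi θ _ x).symm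
  -- (D), (E) powers, affine parts
  obtain ⟨k, hk⟩ := exists_nat_seq_tendsto_angle hm hθ₀0
  set α : ℕ → ℝ := fun j => (k j : ℝ) * (2 * Real.pi / (m j : ℝ)) with hα
  have hαθ : Tendsto α atTop (𝓝 θ₀) := hk
  set b : ℕ → R3 := fun j => c j - rotZ (α j) (c j) with hb
  have hbt : Tendsto b atTop (𝓝 (ξ - rotZ θ₀ ξ)) := hcξ.sub (tendsto_rotZ₂ hαθ hcξ)
  have hPout := hP M a f b (fun j => rotZLIE (α j)) (ξ - rotZ θ₀ ξ) (rotZLIE θ₀) ha hf hweak hbt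
    (fun y => by simpa only [rotZLIE_apply] using tendsto_rotZ₂ hαθ tendsto_const_nhds)
    (fun j y => affine_of_equivariant ((hsym j).iterate (k j)) y)
  -- transport `y = ξ + x`
  have hmp : MeasurePreserving (fun x : R3 => ξ + x) volume volume := measurePreserving_add_left volume ξ
  filter_upwards [hmp.quasiMeasurePreserving.ae_eq_comp hPout] with x hx
  simp only [Function.comp, rotZLIE_apply] at hx
  rw [hrot, hrot, ← hx, rotZ_map_add]
  congr 1
  abel

/-- **Case (i), mirrors.**  If the centres converge and the `a_j` are also mirror-equivariant about `c_j`,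
then (P) makes the weak limit a.e.-mirror-symmetric about `ξ`. -/
theorem aeMirrorSymmetric_of_tendsto_centres (hP : WeakLimitEquivariance)
    (ha : ∀ j, MemLp (a j) 3 volume ∧ eLpNorm (a j) 3 volume ≤ (M : ℝ≥0∞))
    (hmir : ∀ j, IsMirrorEquivariantAbout (c j) (a j))
    (hf : MemLp f 3 volume) (hweak : WeakTo a f) {ξ : R3} (hcξ : Tendsto c atTop (𝓝 ξ)) :
    IsAEMirrorSymmetricAbout ξ f := by
  set b : ℕ → R3 := fun j => c j - reflY (c j) with hb
  have hbt : Tendsto b atTop (𝓝 (ξ - reflY ξ)) := hcξ.sub ((reflY.continuous.tendsto ξ).comp hcξ)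
  have hPout := hP M a f b (fun _ => reflY) (ξ - reflY ξ) reflY ha hf hweak hbt
    (fun y => tendsto_const_nhds)
    (fun j y => by
      have := hmir j y
      rw [map_sub] at this
      rw [← this]
      congr 1
      simp only [hb]
      abel)
  have hmp : MeasurePreserving (fun x : R3 => ξ + x) volume volume := measurePreserving_add_left volume ξ
  show (fun x : R3 => f (ξ + reflY x)) =ᵐ[volume] fun x : R3 => reflY (f (ξ + x))
  filter_upwards [hmp.quasiMeasurePreserving.ae_eq_comp hPout] with x hx
  simp only [Function.comp] at hx
  rw [← hx, map_add]
  congr 1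
  abel

/-- a sequence of reals that does not tend to `+∞` has a convergent subsequence of any sequence of vectors
it bounds — here: the centres. -/
theorem exists_subseq_centres_tendsto (hA : ¬ Tendsto (fun j => ‖c j‖) atTop atTop) :
    ∃ (σ : ℕ → ℕ) (ξ : R3), StrictMono σ ∧ Tendsto (c ∘ σ) atTop (𝓝 ξ) := by
  obtain ⟨R, hfreq⟩ := exists_frequently_le_of_not_tendsto hA
  obtain ⟨σ, hσ, hσR⟩ := Filter.extraction_of_frequently_atTop hfreq
  have hcmem : ∀ j, c (σ j) ∈ Metric.closedBall (0 : R3) R := fun j =>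
    mem_closedBall_zero_iff.2 (hσR j)
  obtain ⟨ξ, -, ψ, hψ, hcξ⟩ := tendsto_subseq_of_bounded Metric.isBounded_closedBall hcmem
  exact ⟨σ ∘ ψ, ξ, hσ.comp hψ, hcξ⟩

/-- **Cases (ii)/(iii).**  If `‖c_j‖ → ∞` the weak limit vanishes: either the orbit spacing diverges and
(V) applies, or along a subsequence it stays bounded, (S) selects powers displacing the origin into a
fixed window with angle `→ 0`, a further subsequence of displacements converges to `t ≠ 0`, (P) (with
`L_j = R_{α_j} → id`) makes `f` `t`-periodic and (Z) gives `f = 0`. -/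
theorem ae_zero_of_norm_centres_tendsto (hP : WeakLimitEquivariance) (hV : FarOrbitVanishing)
    (hZ : PeriodicL3Zero) (hm : Tendsto m atTop atTop) (hc : ∀ j, c j 2 = 0)
    (ha : ∀ j, MemLp (a j) 3 volume ∧ eLpNorm (a j) 3 volume ≤ (M : ℝ≥0∞))
    (hsym : ∀ j, IsCyclicEquivariantAbout (m j) (c j) (a j))
    (hf : MemLp f 3 volume) (hweak : WeakTo a f) (hA : Tendsto (fun j => ‖c j‖) atTop atTop) :
    f =ᵐ[volume] (0 : R3 → R3) := by
  have hπ := Real.pi_pos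
  by_cases hC : Tendsto (fun j => ‖c j‖ * Real.sin (Real.pi / m j)) atTop atTop
  · exact hV M m c a f hm hc ha hsym hf hweak hC
  -- case (ii)
  obtain ⟨D, hfreq⟩ := exists_frequently_le_of_not_tendsto hC
  have hev : ∀ᶠ j in atTop, 2 ≤ ‖c j‖ ∧ 2 ≤ m j :=
    (hA.eventually_ge_atTop 2).and (hm.eventually_ge_atTop 2)
  obtain ⟨σ, hσ, hσP⟩ := Filter.extraction_of_frequently_atTop (hfreq.and_eventually hev)
  -- the window `[1, W]`
  set W : ℝ := max 3 (2 * D) with hW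
  have hk : ∀ j, ∃ k : ℕ, 1 ≤ k ∧ 2 * k ≤ m (σ j) ∧
      1 ≤ 2 * ‖c (σ j)‖ * Real.sin (Real.pi * k / m (σ j)) ∧
      2 * ‖c (σ j)‖ * Real.sin (Real.pi * k / m (σ j)) ≤ W := by
    intro j
    obtain ⟨hdj, hs2, hm2⟩ := hσP j
    by_cases h1 : 2 * ‖c (σ j)‖ * Real.sin (Real.pi / m (σ j)) ≤ 1
    · obtain ⟨k, hk1, hk2, hlo, hhi⟩ := exists_power_window hs2 hm2 h1
      exact ⟨k, hk1, hk2, hlo, hhi.trans (le_max_left _ _)⟩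
    · have e1 : Real.pi * ((1 : ℕ) : ℝ) / (m (σ j) : ℝ) = Real.pi / m (σ j) := by simp
      refine ⟨1, le_rfl, by omega, ?_, ?_⟩
      · rw [e1]; exact (not_le.1 h1).le
      · have : 2 * ‖c (σ j)‖ * Real.sin (Real.pi / m (σ j)) ≤ 2 * D := by nlinarith
        rw [e1]; exact this.trans (le_max_right 3 (2 * D))
  choose k hk1 hk2 hklo hkhi using hk
  -- angles and displacements of the selected powers
  set α : ℕ → ℝ := fun j => (k j : ℝ) * (2 * Real.pi / m (σ j)) with hα
  set b : ℕ → R3 := fun j => c (σ j) - rotZ (α j) (c (σ j)) with hb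
  have hm0 : ∀ j, (0 : ℝ) < m (σ j) := fun j => by
    have := (hσP j).2.2; exact_mod_cast (zero_lt_two.trans_le this)
  have hx : ∀ j, 0 ≤ Real.pi * k j / m (σ j) ∧ Real.pi * k j / m (σ j) ≤ Real.pi / 2 := by
    intro j
    refine ⟨by positivity, ?_⟩
    rw [div_le_div_iff₀ (hm0 j) two_pos]
    have : (2 * k j : ℝ) ≤ m (σ j) := by exact_mod_cast hk2 j
    nlinarith
  have hsin0 : ∀ j, 0 ≤ Real.sin (Real.pi * k j / m (σ j)) := fun j =>
    Real.sin_nonneg_of_nonneg_of_le_pi (hx j).1 ((hx j).2.trans (by linarith))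
  have hbn : ∀ j, ‖b j‖ = 2 * ‖c (σ j)‖ * Real.sin (Real.pi * k j / m (σ j)) := by
    intro j
    simp only [hb]
    rw [norm_sub_rotZ_eq (hc _), show α j / 2 = Real.pi * k j / m (σ j) by
      simp only [hα]; ring, abs_of_nonneg (hsin0 j)]
  -- `α_j → 0`: Jordan's inequality and `‖c_j‖ → ∞`
  have hα0 : Tendsto α atTop (𝓝 0) := by
    have hs : Tendsto (fun j => ‖c (σ j)‖) atTop atTop := hA.comp hσ.tendsto_atTop
    have hup : Tendsto (fun j => Real.pi * W / (2 * ‖c (σ j)‖)) atTop (𝓝 0) :=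
      (tendsto_const_nhds (x := Real.pi * W)).div_atTop
        (hs.const_mul_atTop (show (0:ℝ) < 2 by norm_num))
    refine squeeze_zero (fun j => by positivity) (fun j => ?_) hup
    have hj1 : 2 / Real.pi * (Real.pi * k j / m (σ j)) ≤ Real.sin (Real.pi * k j / m (σ j)) :=
      Real.mul_le_sin (hx j).1 (hx j).2
    have hs2 : (2 : ℝ) ≤ ‖c (σ j)‖ := (hσP j).2.1
    have hspos : 0 < 2 * ‖c (σ j)‖ := by linarith
    rw [le_div_iff₀ hspos]
    have e : α j = 2 * (Real.pi * k j / m (σ j)) := by simp only [hα]; ring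
    rw [e]
    have h3 := hkhi j
    have h4 : 2 / Real.pi * (Real.pi * ↑(k j) / ↑(m (σ j))) = 2 * k j / m (σ j) := by
      field_simp
    rw [h4] at hj1
    have h5 : 2 * (Real.pi * ↑(k j) / ↑(m (σ j))) * (2 * ‖c (σ j)‖)
        = Real.pi * (2 * ‖c (σ j)‖ * (2 * k j / m (σ j))) := by ring
    rw [h5]
    have h6 : 2 * ‖c (σ j)‖ * (2 * ↑(k j) / ↑(m (σ j))) ≤ W := by
      have := mul_le_mul_of_nonneg_left hj1 hspos.le
      linarith
    nlinarith
  -- a convergent subsequence of displacements, limit `t ≠ 0`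
  have hbmem : ∀ j, b j ∈ Metric.closedBall (0 : R3) W := fun j => by
    rw [mem_closedBall_zero_iff, hbn]; exact hkhi j
  obtain ⟨t, -, ψ, hψ, hbt⟩ := tendsto_subseq_of_bounded Metric.isBounded_closedBall hbmem
  have ht1 : 1 ≤ ‖t‖ := by
    refine ge_of_tendsto (hbt.norm) (Eventually.of_forall fun j => ?_)
    simp only [Function.comp]
    rw [hbn]; exact hklo (ψ j)
  have ht : t ≠ 0 := by
    intro h0; rw [h0, norm_zero] at ht1; exact absurd ht1 (by norm_num)
  -- (P) along `σ ∘ ψ` with `L_j = R_{α_{ψ j}} → id`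
  have hα0' : Tendsto (fun j => α (ψ j)) atTop (𝓝 0) := hα0.comp hψ.tendsto_atTop
  have hPout := hP M (fun j => a (σ (ψ j))) f (b ∘ ψ) (fun j => rotZLIE (α (ψ j))) t
    (LinearIsometryEquiv.refl ℝ R3) (fun j => ha _) hf (hweak.comp (hσ.comp hψ)) hbt
    (fun y => by
      simpa only [rotZLIE_apply, LinearIsometryEquiv.coe_refl, id] using
        tendsto_rotZ_of_tendsto_zero hα0' y)
    (fun j y => affine_of_equivariant ((hsym (σ (ψ j))).iterate (k (ψ j))) y)
  refine hZ f t ht hf ?_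
  filter_upwards [hPout] with y hy
  simpa only [LinearIsometryEquiv.coe_refl, id, add_comm t y] using hy

/-- **S2 from its two analytic sub-stubs (P), (V)** (and the PROVED (Z)): trichotomy on the centres. -/
theorem profileRigidity_of (hP : WeakLimitEquivariance) (hV : FarOrbitVanishing) (hZ : PeriodicL3Zero)
    (hm : Tendsto m atTop atTop) (hc : ∀ j, c j 2 = 0)
    (ha : ∀ j, MemLp (a j) 3 volume ∧ eLpNorm (a j) 3 volume ≤ (M : ℝ≥0∞))
    (hsym : ∀ j, IsCyclicEquivariantAbout (m j) (c j) (a j))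
    (hf : MemLp f 3 volume) (hweak : WeakTo a f) :
    ∃ ξ : R3, ξ 2 = 0 ∧ IsAEAxisymmetricAbout ξ f := by
  by_cases hA : Tendsto (fun j => ‖c j‖) atTop atTop
  · have h0 := ae_zero_of_norm_centres_tendsto hP hV hZ hm hc ha hsym hf hweak hA
    exact ⟨0, rfl, (isAEAxisymmetricAbout_zero 0).congr_ae (by exact h0.symm)⟩
  · obtain ⟨σ, ξ, hσ, hcξ⟩ := exists_subseq_centres_tendsto hA
    have hξ : ξ 2 = 0 := horizontal_of_tendsto (fun j => hc (σ j)) hcξ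
    exact ⟨ξ, hξ, aeAxisymmetric_of_tendsto_centres (c := c ∘ σ) hP (hm.comp hσ.tendsto_atTop)
      (fun j => ha (σ j)) (fun j => hsym (σ j)) hf (hweak.comp hσ) hcξ⟩

/-- **S2ᴰ (LINE 14) from the same two sub-stubs**: with mirror-equivariant approximants the limit is
moreover a.e.-mirror-symmetric about the same axis (case (i): (P) once more with `L_j = reflY`;
cases (ii)/(iii): `f = 0`). -/
theorem profileRigidityD_of (hP : WeakLimitEquivariance) (hV : FarOrbitVanishing) (hZ : PeriodicL3Zero)
    (hm : Tendsto m atTop atTop) (hc : ∀ j, c j 2 = 0)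
    (ha : ∀ j, MemLp (a j) 3 volume ∧ eLpNorm (a j) 3 volume ≤ (M : ℝ≥0∞))
    (hsym : ∀ j, IsCyclicEquivariantAbout (m j) (c j) (a j))
    (hmir : ∀ j, IsMirrorEquivariantAbout (c j) (a j))
    (hf : MemLp f 3 volume) (hweak : WeakTo a f) :
    ∃ ξ : R3, ξ 2 = 0 ∧ IsAEAxisymmetricAbout ξ f ∧ IsAEMirrorSymmetricAbout ξ f := by
  by_cases hA : Tendsto (fun j => ‖c j‖) atTop atTop
  · have h0 := ae_zero_of_norm_centres_tendsto hP hV hZ hm hc ha hsym hf hweak hA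
    exact ⟨0, rfl, (isAEAxisymmetricAbout_zero 0).congr_ae (by exact h0.symm),
      (isAEMirrorSymmetricAbout_zero 0).congr_ae (by exact h0.symm)⟩
  · obtain ⟨σ, ξ, hσ, hcξ⟩ := exists_subseq_centres_tendsto hA
    have hξ : ξ 2 = 0 := horizontal_of_tendsto (fun j => hc (σ j)) hcξ
    exact ⟨ξ, hξ, aeAxisymmetric_of_tendsto_centres (c := c ∘ σ) hP (hm.comp hσ.tendsto_atTop)
      (fun j => ha (σ j)) (fun j => hsym (σ j)) hf (hweak.comp hσ) hcξ,
      aeMirrorSymmetric_of_tendsto_centres (c := c ∘ σ) hP (fun j => ha (σ j)) (fun j => hmir (σ j))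
      hf (hweak.comp hσ) hcξ⟩

end Composition

/-- **S2ᴰ (profile rigidity at diverging dihedral order); rev 2: PROVED from the stubs (P), (V) by
`profileRigidityD_of` and the proved (Z).**  Let `a_j` be `L³` fields with
`‖a_j‖₃ ≤ M`, `C_{m_j}`-equivariant about vertical axes through horizontal centres `c_j` and
mirror-equivariant in the parallel vertical planes through `c_j`, `m_j → ∞`, converging weakly (against test
fields) to `f ∈ L³`.  Then `f` is a.e.-axisymmetric AND a.e.-mirror-symmetric about some vertical axis.
Trichotomy (after subsequences) on `s_j = |c_j|` and `d_j = 2 s_j sin(π/m_j)`: (i) `s_j` bounded, `c_j → ξ`: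
rotations by `2πk_j/m_j → θ` about `c_j` converge locally uniformly to the rotation by `θ` about `ξ`, the
mirrors about `c_j` to the mirror about `ξ`; equivariance passes to weak limits; (ii) `s_j → ∞`, `d_j`
bounded: suitable powers converge to a non-zero horizontal translation, `f` is periodic and in `L³`, so
`f = 0` (`PeriodicL3Zero`); (iii) `d_j → ∞`: the `m_j` rotated copies of a test field have disjoint supports
and pair identically with `a_j`, so `|⟨a_j, φ⟩| ≤ M m_j^{-1/3} ‖φ‖_{3/2} → 0` and `f = 0` (the BUDGET is used
here only).  `0` is symmetric (`isAEAxisymmetricAbout_zero`, `isAEMirrorSymmetricAbout_zero`).  This is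
LINE 13's S2 plus the passage of the mirror to the limit in case (i). -/
theorem profileRigidityD {M : ℝ≥0} {m : ℕ → ℕ} {c : ℕ → R3} {a : ℕ → R3 → R3} {f : R3 → R3}
    (hm : Tendsto m atTop atTop) (hc : ∀ j, c j 2 = 0)
    (ha : ∀ j, MemLp (a j) 3 volume ∧ eLpNorm (a j) 3 volume ≤ (M : ℝ≥0∞))
    (hsym : ∀ j, IsCyclicEquivariantAbout (m j) (c j) (a j))
    (hmir : ∀ j, IsMirrorEquivariantAbout (c j) (a j))
    (hf : MemLp f 3 volume)
    (hweak : ∀ φ : R3 → R3, FunctionSpaces.IsTestFunctionOn (⊤ : Opens R3) φ →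
      Tendsto (fun j => ∫ x, ⟪a j x, φ x⟫) atTop (𝓝 (∫ x, ⟪f x, φ x⟫))) :
    ∃ ξ : R3, ξ 2 = 0 ∧ IsAEAxisymmetricAbout ξ f ∧ IsAEMirrorSymmetricAbout ξ f :=
  profileRigidityD_of weakLimitEquivariance_holds farOrbitVanishing_holds periodicL3Zero_holds hm hc ha hsym
    hmir hf hweak


end Summit.NavierStokesRegularity.NavierStokesRegularity.Theorems.ScenarioCensus.LargeOrderRigidity

end
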